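import Summits.Ventures.Crystal3D.Theorems.StickyWulffConstantNoReconstructionGainExactFlatCore
import HarnessLib

/-!
# Flat lattice translations at every normal, II: counting (line `replication-exactness`, brick for REPLICATION)

HONEST FRAMING. Part of the venture `Summits/Ventures/Crystal3D` (cell `crystal3d-full`), supports the
crux `NoReconstructionGain` (stmt-Ventures-19144, route `route-Ventures-StickyWulffConstant`), line
`replication-exactness` (skeleton v2, lead wulff-p1 g17), brick for the licence stub `stub_replication`:

* `exists_flatTranslations` — **FLAT TRANSLATIONS BY PIGEONHOLE, every unit normal `ν`, no face
  lattice**: for every `0 < δ ≤ 1` and every separation `m ≥ 1` there are `c > 0` and `ρ₀ ≥ 1` such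
  that for every `ρ ≥ ρ₀` at least `c ρ²` vectors of `Λ₀` of norm `≤ ρ`, pairwise `≥ m` apart, have
  `ν`-heights in one window `[a, a + δ)` with `|a| ≤ m + 2` (`flatGrid_of_core` does the `ρ`-bookkeeping
  of `flatGrid_core` with `n = ⌊ρ/(5m)⌋`, `c = 1/(50 m² (2K+1))`, `ρ₀ = 50 m² (2K+1)`; the three
  arrangements of the generators cover every `ν`).

WHAT THIS IS NOT: the replication argument itself (assembly of the packing) is the next brick; rung F-C1
not moved.
-/

noncomputable section

namespace Summit.Ventures.Crystal3D.Theorems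

open Literature.MathematicalPhysics.StatisticalMechanics (fccStacking barlowStacking barlowPos constHagg)
open scoped InnerProductSpace
open Finset

/-! ## Flat translations at every normal -/

/-- **The `ρ`-bookkeeping of the core**: `c ρ²` flat, separated lattice translations of norm `≤ ρ`. -/
theorem flatGrid_of_core (ν : EuclideanSpace ℝ (Fin 3)) (hν : ‖ν‖ = 1) (f₁ f₂ f₃ : EuclideanSpace ℝ (Fin 3))
    (hf : ∀ i j k : ℤ, (i : ℝ) • f₁ + (j : ℝ) • f₂ + (k : ℝ) • f₃ ∈ fccStacking 1 (Real.sqrt (2 / 3)))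
    (hind : ∀ i j k : ℤ, (i : ℝ) • f₁ + (j : ℝ) • f₂ + (k : ℝ) • f₃ = 0 → i = 0 ∧ j = 0)
    (hn₁ : ‖f₁‖ ≤ 1) (hn₂ : ‖f₂‖ ≤ 1) (hn₃ : ‖f₃‖ ≤ 1)
    (h₃ : ⟪f₃, ν⟫_ℝ ≠ 0) (h₁₃ : |⟪f₁, ν⟫_ℝ| ≤ |⟪f₃, ν⟫_ℝ|) (h₂₃ : |⟪f₂, ν⟫_ℝ| ≤ |⟪f₃, ν⟫_ℝ|)
    (δ : ℝ) (hδ : 0 < δ) (hδ1 : δ ≤ 1) (m : ℕ) (hm : 1 ≤ m) :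
    ∃ c : ℝ, 0 < c ∧ ∃ ρ₀ : ℝ, 1 ≤ ρ₀ ∧ ∀ ρ : ℝ, ρ₀ ≤ ρ →
      ∃ T : Finset (EuclideanSpace ℝ (Fin 3)),
        (∀ t ∈ T, t ∈ fccStacking 1 (Real.sqrt (2 / 3))) ∧ (∀ t ∈ T, ‖t‖ ≤ ρ) ∧
        (∀ t ∈ T, ∀ t' ∈ T, t ≠ t' → (m : ℝ) ≤ dist t t') ∧
        (∃ a : ℝ, |a| ≤ m + 2 ∧ ∀ t ∈ T, a ≤ ⟪t, ν⟫_ℝ ∧ ⟪t, ν⟫_ℝ < a + δ) ∧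
        c * ρ ^ 2 ≤ T.card := by
  set K' : ℕ := 2 * (⌈(m : ℝ) / δ⌉₊ + 1) + 1 with hK'
  have hK'pos : (0 : ℝ) < K' := by rw [hK']; positivity
  have hK'1 : (1 : ℝ) ≤ K' := by rw [hK']; exact_mod_cast (by omega : 1 ≤ 2 * (⌈(m : ℝ) / δ⌉₊ + 1) + 1)
  have hm1 : (1 : ℝ) ≤ m := by exact_mod_cast hm
  have hmpos : (0 : ℝ) < m := by linarith
  refine ⟨1 / (50 * (m : ℝ) ^ 2 * K'), by positivity, 50 * (m : ℝ) ^ 2 * K', ?_, ?_⟩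
  · nlinarith
  intro ρ hρ
  have hρ1 : 1 ≤ ρ := by nlinarith
  have hρ5m : 5 * (m : ℝ) ≤ ρ := by nlinarith
  set n : ℕ := ⌊ρ / (5 * m)⌋₊ with hn
  obtain ⟨T, h1, h2, h3, h4, h5⟩ :=
    flatGrid_core ν hν f₁ f₂ f₃ hf hind hn₁ hn₂ hn₃ h₃ h₁₃ h₂₃ δ hδ hδ1 m hm n
  have hnle : (n : ℝ) ≤ ρ / (5 * m) := Nat.floor_le (by positivity)
  have hnlt : ρ / (5 * m) < n + 1 := Nat.lt_floor_add_one _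
  refine ⟨T, h1, ?_, h3, h4, ?_⟩
  · intro t ht
    have := h2 t ht
    have h6 : (m : ℝ) * (4 * n + 1) ≤ ρ := by
      have : (m : ℝ) * n ≤ ρ / 5 := by
        have h := mul_le_mul_of_nonneg_left hnle hmpos.le
        rwa [show (m : ℝ) * (ρ / (5 * m)) = ρ / 5 by field_simp] at h
      nlinarith
    linarith
  · -- the count
    have hq : ((2 * n + 1) ^ 2 : ℕ) < ((2 * n + 1) ^ 2 / K' + 1) * K' := by
      have := Nat.lt_div_mul_add (a := (2 * n + 1) ^ 2) (show 0 < K' by omega)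
      linarith [Nat.add_mul ((2 * n + 1) ^ 2 / K') 1 K']
    have hq' : (((2 * n + 1) ^ 2 : ℕ) : ℝ) < ((((2 * n + 1) ^ 2 / K' : ℕ) : ℝ) + 1) * K' := by
      exact_mod_cast hq
    have hcard : ((((2 * n + 1) ^ 2 / K' : ℕ)) : ℝ) ≤ T.card := by exact_mod_cast h5
    have h2n : ρ / (5 * m) ≤ (2 * n + 1 : ℝ) := by linarith
    have hsq : (ρ / (5 * m)) ^ 2 ≤ (((2 * n + 1) ^ 2 : ℕ) : ℝ) := by
      push_cast
      have h0 : 0 ≤ ρ / (5 * m) := by positivity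
      nlinarith
    have hsq' : (ρ / (5 * m)) ^ 2 = ρ ^ 2 / (25 * m ^ 2) := by
      field_simp; ring
    -- `q + 1 > ρ²/(25 m² K')`, and `ρ² ≥ 50 m² K'`
    have hρ2 : 50 * (m : ℝ) ^ 2 * K' ≤ ρ ^ 2 := by nlinarith
    have hgoal : 1 / (50 * (m : ℝ) ^ 2 * K') * ρ ^ 2 ≤ (((2 * n + 1) ^ 2 / K' : ℕ) : ℝ) := by
      rw [hsq'] at hsq
      have e1 : ρ ^ 2 / (25 * m ^ 2) / K' < (((2 * n + 1) ^ 2 / K' : ℕ) : ℝ) + 1 := by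
        rw [div_lt_iff₀ hK'pos]; linarith
      have e2 : 1 / (50 * (m : ℝ) ^ 2 * K') * ρ ^ 2 = ρ ^ 2 / (25 * m ^ 2) / K' / 2 := by
        field_simp; ring
      have e3 : 1 ≤ ρ ^ 2 / (25 * m ^ 2) / K' / 2 := by
        rw [le_div_iff₀ (by norm_num : (0:ℝ) < 2), le_div_iff₀ hK'pos, le_div_iff₀ (by positivity)]
        linarith
      rw [e2]; linarith
    exact hgoal.trans hcard

/-- **Flat lattice translations at every normal** (pigeonhole on the heights of a separated grid of
`Λ₀`; no face lattice is needed): for `0 < δ ≤ 1` and a separation `m ≥ 1` there are `c > 0` and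
`ρ₀ ≥ 1` such that for every `ρ ≥ ρ₀` some `c ρ²` vectors of `Λ₀` of norm `≤ ρ`, pairwise `≥ m` apart,
have `ν`-heights in one window `[a, a + δ)` with `|a| ≤ m + 2`. -/
theorem exists_flatTranslations (ν : EuclideanSpace ℝ (Fin 3)) (hν : ‖ν‖ = 1) (δ : ℝ) (hδ : 0 < δ)
    (hδ1 : δ ≤ 1) (m : ℕ) (hm : 1 ≤ m) :
    ∃ c : ℝ, 0 < c ∧ ∃ ρ₀ : ℝ, 1 ≤ ρ₀ ∧ ∀ ρ : ℝ, ρ₀ ≤ ρ →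
      ∃ T : Finset (EuclideanSpace ℝ (Fin 3)),
        (∀ t ∈ T, t ∈ fccStacking 1 (Real.sqrt (2 / 3))) ∧ (∀ t ∈ T, ‖t‖ ≤ ρ) ∧
        (∀ t ∈ T, ∀ t' ∈ T, t ≠ t' → (m : ℝ) ≤ dist t t') ∧
        (∃ a : ℝ, |a| ≤ m + 2 ∧ ∀ t ∈ T, a ≤ ⟪t, ν⟫_ℝ ∧ ⟪t, ν⟫_ℝ < a + δ) ∧
        c * ρ ^ 2 ≤ T.card := by
  set e₁ := barlowPos 1 (Real.sqrt (2 / 3)) constHagg 0 1 0 with he₁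
  set e₂ := barlowPos 1 (Real.sqrt (2 / 3)) constHagg 0 0 1 with he₂
  set e₃ := barlowPos 1 (Real.sqrt (2 / 3)) constHagg 1 0 0 with he₃
  obtain ⟨hn1, hn2, hn3⟩ := norm_fcc_gen
  have hne := inner_fcc_gen_ne_zero hν
  -- the three arrangements of the generators
  by_cases hA : |⟪e₁, ν⟫_ℝ| ≤ |⟪e₃, ν⟫_ℝ| ∧ |⟪e₂, ν⟫_ℝ| ≤ |⟪e₃, ν⟫_ℝ|
  · have h3 : ⟪e₃, ν⟫_ℝ ≠ 0 := by
      intro h0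
      rw [h0, abs_zero] at hA
      have h1 : ⟪e₁, ν⟫_ℝ = 0 := abs_eq_zero.1 (le_antisymm hA.1 (abs_nonneg _))
      have h2 : ⟪e₂, ν⟫_ℝ = 0 := abs_eq_zero.1 (le_antisymm hA.2 (abs_nonneg _))
      rcases hne with h | h | h <;> [exact h h1; exact h h2; exact h h0]
    exact flatGrid_of_core ν hν e₁ e₂ e₃ (fun i j k => fcc_comb_mem i j k)
      (fun i j k h => let ⟨a, b, _⟩ := fcc_comb_eq_zero h; ⟨a, b⟩) hn1.le hn2.le hn3.le h3 hA.1 hA.2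
      δ hδ hδ1 m hm
  · rw [not_and_or, not_le, not_le] at hA
    by_cases hB : |⟪e₂, ν⟫_ℝ| ≤ |⟪e₁, ν⟫_ℝ|
    · -- `e₁` carries the largest height: use `(e₂, e₃, e₁)`
      have h13 : |⟪e₃, ν⟫_ℝ| ≤ |⟪e₁, ν⟫_ℝ| := by
        rcases hA with h | h
        · exact h.le
        · exact (h.trans_le hB).le
      have h1 : ⟪e₁, ν⟫_ℝ ≠ 0 := by
        intro h0
        rw [h0, abs_zero] at hB h13
        have h2 : ⟪e₂, ν⟫_ℝ = 0 := abs_eq_zero.1 (le_antisymm hB (abs_nonneg _))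
        have h3 : ⟪e₃, ν⟫_ℝ = 0 := abs_eq_zero.1 (le_antisymm h13 (abs_nonneg _))
        rcases hne with h | h | h <;> [exact h h0; exact h h2; exact h h3]
      refine flatGrid_of_core ν hν e₂ e₃ e₁ ?_ ?_ hn2.le hn3.le hn1.le h1 hB h13 δ hδ hδ1 m hm
      · intro i j k
        have := fcc_comb_mem k i j
        convert this using 1
        module
      · intro i j k h
        have h' : (k : ℝ) • e₁ + (i : ℝ) • e₂ + (j : ℝ) • e₃ = 0 := by rw [← h]; module
        obtain ⟨_, a, b⟩ := fcc_comb_eq_zero h'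
        exact ⟨a, b⟩
    · -- `e₂` carries the largest height: use `(e₁, e₃, e₂)`
      rw [not_le] at hB
      have h32 : |⟪e₃, ν⟫_ℝ| ≤ |⟪e₂, ν⟫_ℝ| := by
        rcases hA with h | h
        · exact (h.trans hB).le
        · exact h.le
      have h2 : ⟪e₂, ν⟫_ℝ ≠ 0 := by
        intro h0
        rw [h0, abs_zero] at hB
        exact absurd hB (not_lt.2 (abs_nonneg _))
      refine flatGrid_of_core ν hν e₁ e₃ e₂ ?_ ?_ hn1.le hn3.le hn2.le h2 hB.le h32 δ hδ hδ1 m hm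
      · intro i j k
        have := fcc_comb_mem i k j
        convert this using 1
        module
      · intro i j k h
        have h' : (i : ℝ) • e₁ + (k : ℝ) • e₂ + (j : ℝ) • e₃ = 0 := by rw [← h]; module
        obtain ⟨a, _, b⟩ := fcc_comb_eq_zero h'
        exact ⟨a, b⟩

end Summit.Ventures.Crystal3D.Theorems

end
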